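import Mathlib.Analysis.SpecialFunctions.Complex.LogBounds
import Mathlib.Analysis.SpecialFunctions.Integrals.PosLogEqCircleAverage
import Mathlib.Analysis.SpecialFunctions.Integrability.LogMeromorphic
import Mathlib.MeasureTheory.Integral.IntervalIntegral.Periodic
import Mathlib.MeasureTheory.Integral.DominatedConvergence
import Mathlib.MeasureTheory.Integral.Prod
import HarnessLib

/-!
# The logarithmic kernel of the unit circle, its Poisson regularisation, and logarithmic energies

Topic `Analysis/Potential`, namespace `Literature.Analysis.Potential`. Elementary potential theory
of the unit circle in the ANGULAR variable, as needed for mean-field (Coulomb-gas) limits of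
circular `β = 2` ensembles (e.g. the Gross–Witten unitary matrix model,
`Literature.Barriers.QuantumFields.GrossWittenLargeNFreeEnergy`): everything here is classical
("folklore"; cf. Ransford, *Potential Theory in the Complex Plane*, Ch. 3, and Saff–Totik,
*Logarithmic Potentials with External Fields*, Ch. I §1 for the negative-definiteness of the
logarithmic kernel on measures of equal mass) and is PROVED from Mathlib.

## Contents (all proved)

* `circleLogKernel v = log ‖1 − e^{iv}‖` (`= log |2 sin (v/2)|`, so `log |e^{is} − e^{it}| = ℓ(s−t)`)
  and its regularisation `circleLogKernelR r v = log ‖1 − r e^{iv}‖` (the kernel between `e^{iv}`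
  and the interior point `r`); closed forms, evenness, `2π`-periodicity, continuity (`r < 1`),
  measurability, interval integrability (log-norm of a real-analytic map,
  `MeromorphicOn.intervalIntegrable_log_norm`).
* (L1) the regularisation inequality `ℓ(v) + (log r)/2 ≤ ℓ_r(v)` off `2πℤ`
  (`circleLogKernel_add_le`, from `‖1 − r e^{iv}‖² = (1−r)² + r ‖1 − e^{iv}‖²`), and `ℓ_r ≤ log 2`.
* (L2) the Fourier expansion `ℓ_r(v) = −∑_{m≥1} rᵐ cos (m v)/m` (`hasSum_circleLogKernelR`, real part
  of Mathlib's `Complex.hasSum_taylorSeries_neg_log`).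
* (L0) the Fourier moments `∫_{-π}^{π} ℓ_r = 0`, `∫ ℓ_r cos = −π r`, `∫ ℓ_r sin = 0` (termwise) and,
  letting `r ↑ 1` by dominated convergence, `∫_{-π}^{π} ℓ = 0`, `∫ ℓ cos = −π`, `∫ ℓ sin = 0`
  (`integral_circleLogKernel`, `integral_circleLogKernel_mul_cos`, `…_mul_sin`); the convolutions
  `∫ ℓ(u − β)(a + b cos β) dβ = −π b cos u` and the `ℓ_r` analogue.
* Potentials and energies of finite measures on `ℝ` (angles): `circleLogPotential μ t = ∫ ℓ(t−s) dμ`,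
  `circleLogPotentialR μ r t`, `circleLogEnergy μ = ∫ U^μ dμ`, the mutual regularised energy
  `circleLogEnergyR μ ν r = ∫ U_r^ν dμ`, cosine/sine moments; Fourier expansions
  (`hasSum_circleLogPotentialR`, `hasSum_circleLogEnergyR`).
* (L3) **negative type**: `E_r(μ,μ) + E_r(ν,ν) ≤ 2 E_r(μ,ν)` for ALL finite `μ, ν` and `0 ≤ r < 1`
  (`circleLogEnergyR_add_le`; the difference is `−∑ rᵐ/m · |μ̂_m − ν̂_m|²`).
* Measures dominated by Lebesgue on a period, `μ ≤ M · vol|[-π,π]`: integrability and boundedness of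
  potentials, `E(μ) + (log r/2) μ(ℝ)² ≤ E_r(μ,μ)` (`circleLogEnergy_add_le_circleLogEnergyR`).
* (L4) **smoothing**: `U_r^μ ≤ U^μ + M η(r)` with `η(r) = ∫_{-π}^{π} (ℓ_r − ℓ)⁺ → 0` as `r ↑ 1`
  (`circleLogPotentialR_le`, `tendsto_circleLogExcess`).
* Identities for explicit potentials: `ℓ(x−y) + ℓ(x+y) = log (2|cos x − cos y|)` and the Joukowski
  form `log ((ρ+ρ⁻¹)/2 + cos β) = 2 ℓ_ρ(β+π) − log (2ρ)`.

## Design choices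

* Angles live on `ℝ` (not `AddCircle`/`Real.Angle`): all statements are about `2π`-periodic
  functions and interval integrals over `[-π, π]`, which is what the Coulomb-gas integrals over
  `[-π,π]ⁿ` consume directly; no Fourier-analytic machinery beyond termwise integration of an
  absolutely convergent series is used (in particular no Parseval and no Poisson kernel).
* Junk values: `ℓ(v) = Real.log 0 = 0` on `2πℤ`; every statement that needs the genuine `−∞` is
  phrased off that (countable, null) set (`ae_exp_mul_I_ne_one`, `ae_exp_sub_ne_one`).

## Mathlib status

Mathlib has the mean of `log ‖· − a‖` over circles (`circleAverage_log_norm_sub_const_eq_posLog`),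
harmonic-function mean values and the complex `log` Taylor series, but no logarithmic
potentials/energies of measures, no negative-definiteness of the logarithmic kernel and no
equilibrium/Frostman theory (searched: `logPotential`, `logEnergy`, `Frostman`, `equilibrium
measure`, `capacity`).
-/

noncomputable section

open _root_.MeasureTheory _root_.Filter _root_.Set _root_.Complex intervalIntegral
open scoped _root_.Topology Real

namespace Literature.Analysis.Potential

/-- The **logarithmic kernel of the unit circle** in the angular variable:
`ℓ(v) = log |1 − e^{iv}| = log |2 sin (v/2)|`, so that `log |e^{is} − e^{it}| = ℓ(s − t)`.
(At `v ∈ 2πℤ` the value is Lean's junk `Real.log 0 = 0`.) [folklore] -/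
def circleLogKernel (v : ℝ) : ℝ := Real.log ‖1 - cexp (v * I)‖

/-- The **regularised logarithmic kernel** `ℓ_r(v) = log |1 − r e^{iv}|`, i.e. the logarithmic
kernel evaluated between the boundary point `e^{iv}` and the interior point `r` (for `0 ≤ r < 1` a
harmonic, hence smooth, function of the angle; `ℓ_1 = ℓ`). [folklore] -/
def circleLogKernelR (r v : ℝ) : ℝ := Real.log ‖1 - (r : ℂ) * cexp (v * I)‖

/-- `|1 − r e^{iv}|² = 1 − 2 r cos v + r²`. [folklore] -/
theorem norm_one_sub_mul_exp_sq (r v : ℝ) :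
    ‖1 - (r : ℂ) * cexp (v * I)‖ ^ 2 = 1 - 2 * r * Real.cos v + r ^ 2 := by
  rw [Complex.sq_norm, Complex.normSq_apply]
  simp only [sub_re, one_re, mul_re, ofReal_re, ofReal_im, sub_im, one_im, mul_im,
    Complex.exp_ofReal_mul_I_re, Complex.exp_ofReal_mul_I_im]
  nlinarith [Real.sin_sq_add_cos_sq v]

/-- `|1 − e^{iv}|² = 2 − 2 cos v`. [folklore] -/
theorem norm_one_sub_exp_sq (v : ℝ) : ‖1 - cexp (v * I)‖ ^ 2 = 2 - 2 * Real.cos v := by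
  have h := norm_one_sub_mul_exp_sq 1 v
  push_cast at h
  rw [one_mul] at h
  linarith

/-- The key pointwise identity behind the regularisation:
`|1 − r e^{iv}|² = (1 − r)² + r |1 − e^{iv}|²`. [folklore] -/
theorem norm_one_sub_mul_exp_sq_eq (r v : ℝ) :
    ‖1 - (r : ℂ) * cexp (v * I)‖ ^ 2 = (1 - r) ^ 2 + r * ‖1 - cexp (v * I)‖ ^ 2 := by
  rw [norm_one_sub_mul_exp_sq, norm_one_sub_exp_sq]; ring

/-- `ℓ_1 = ℓ`. [folklore] -/
@[simp] theorem circleLogKernelR_one : circleLogKernelR 1 = circleLogKernel := by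
  ext v; simp [circleLogKernelR, circleLogKernel]

/-- `e^{iv} = 1` exactly on `2πℤ`. [folklore] -/
theorem exp_mul_I_eq_one_iff (v : ℝ) : cexp (v * I) = 1 ↔ ∃ m : ℤ, v = 2 * π * m := by
  rw [Complex.exp_eq_one_iff]
  constructor
  · rintro ⟨m, hm⟩
    refine ⟨m, ?_⟩
    have := congrArg Complex.im hm
    simp at this
    linarith
  · rintro ⟨m, rfl⟩
    exact ⟨m, by push_cast; ring⟩

/-- Off `2πℤ` the kernel point `1 − e^{iv}` is non-zero. [folklore] -/
theorem norm_one_sub_exp_pos {v : ℝ} (hv : cexp (v * I) ≠ 1) : 0 < ‖1 - cexp (v * I)‖ :=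
  norm_pos_iff.2 (sub_ne_zero.2 (Ne.symm hv))

/-- For `0 ≤ r` the regularised kernel point satisfies `|1 − r e^{iv}| ≥ 1 − r`. [folklore] -/
theorem one_sub_le_norm_one_sub_mul_exp {r : ℝ} (hr0 : 0 ≤ r) (v : ℝ) :
    1 - r ≤ ‖1 - (r : ℂ) * cexp (v * I)‖ := by
  have h : ‖(r : ℂ) * cexp (v * I)‖ = r := by
    simp [Complex.norm_exp_ofReal_mul_I, abs_of_nonneg hr0]
  calc 1 - r = ‖(1 : ℂ)‖ - ‖(r : ℂ) * cexp (v * I)‖ := by rw [h]; simp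
    _ ≤ ‖1 - (r : ℂ) * cexp (v * I)‖ := norm_sub_norm_le _ _

/-- `|1 − r e^{iv}| ≤ 1 + r` for `0 ≤ r`. [folklore] -/
theorem norm_one_sub_mul_exp_le {r : ℝ} (hr0 : 0 ≤ r) (v : ℝ) :
    ‖1 - (r : ℂ) * cexp (v * I)‖ ≤ 1 + r := by
  have h : ‖(r : ℂ) * cexp (v * I)‖ = r := by
    simp [Complex.norm_exp_ofReal_mul_I, abs_of_nonneg hr0]
  calc ‖1 - (r : ℂ) * cexp (v * I)‖ ≤ ‖(1 : ℂ)‖ + ‖(r : ℂ) * cexp (v * I)‖ := norm_sub_le _ _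
    _ = 1 + r := by rw [h]; simp

/-- `ℓ_r ≤ log 2` for `0 ≤ r ≤ 1`. [folklore] -/
theorem circleLogKernelR_le_log_two {r : ℝ} (hr0 : 0 ≤ r) (hr1 : r ≤ 1) (v : ℝ) :
    circleLogKernelR r v ≤ Real.log 2 := by
  unfold circleLogKernelR
  by_cases h0 : ‖1 - (r : ℂ) * cexp (v * I)‖ = 0
  · rw [h0, Real.log_zero]; exact Real.log_nonneg one_le_two
  · exact Real.log_le_log (lt_of_le_of_ne (norm_nonneg _) (Ne.symm h0))
      ((norm_one_sub_mul_exp_le hr0 v).trans (by linarith))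

/-- `ℓ ≤ log 2`. [folklore] -/
theorem circleLogKernel_le_log_two (v : ℝ) : circleLogKernel v ≤ Real.log 2 := by
  simpa using circleLogKernelR_le_log_two zero_le_one le_rfl v

/-- `log (1 − r) ≤ ℓ_r` for `0 ≤ r < 1`. [folklore] -/
theorem log_one_sub_le_circleLogKernelR {r : ℝ} (hr0 : 0 ≤ r) (hr1 : r < 1) (v : ℝ) :
    Real.log (1 - r) ≤ circleLogKernelR r v :=
  Real.log_le_log (by linarith) (one_sub_le_norm_one_sub_mul_exp hr0 v)

/-- `|ℓ_r| ≤ log 2 − log (1 − r)` for `0 ≤ r < 1`. [folklore] -/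
theorem abs_circleLogKernelR_le {r : ℝ} (hr0 : 0 ≤ r) (hr1 : r < 1) (v : ℝ) :
    |circleLogKernelR r v| ≤ Real.log 2 - Real.log (1 - r) := by
  have h1 := circleLogKernelR_le_log_two hr0 hr1.le v
  have h2 := log_one_sub_le_circleLogKernelR hr0 hr1 v
  have h3 : Real.log (1 - r) ≤ 0 := Real.log_nonpos (by linarith) (by linarith)
  have h4 : 0 ≤ Real.log 2 := Real.log_nonneg one_le_two
  rw [abs_le]; constructor <;> linarith

/-- **Regularisation inequality (L1).** Off `2πℤ`,
`ℓ(v) + (log r)/2 ≤ ℓ_r(v)` for `0 < r`, from `|1 − r e^{iv}|² ≥ r |1 − e^{iv}|²`. [folklore] -/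
theorem circleLogKernel_add_le {r : ℝ} (hr0 : 0 < r) {v : ℝ} (hv : cexp (v * I) ≠ 1) :
    circleLogKernel v + Real.log r / 2 ≤ circleLogKernelR r v := by
  have hpos := norm_one_sub_exp_pos hv
  have hsq : r * ‖1 - cexp (v * I)‖ ^ 2 ≤ ‖1 - (r : ℂ) * cexp (v * I)‖ ^ 2 := by
    rw [norm_one_sub_mul_exp_sq_eq]; nlinarith
  have hpos' : 0 < ‖1 - (r : ℂ) * cexp (v * I)‖ := by
    have : 0 < ‖1 - (r : ℂ) * cexp (v * I)‖ ^ 2 := lt_of_lt_of_le (by positivity) hsq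
    exact lt_of_le_of_ne (norm_nonneg _) fun h => by simp [← h] at this
  have hlog := Real.log_le_log (by positivity) hsq
  rw [Real.log_mul hr0.ne' (by positivity), Real.log_pow, Real.log_pow] at hlog
  unfold circleLogKernel circleLogKernelR
  push_cast at hlog
  linarith

/-- **Fourier expansion of the regularised kernel (L2).** For `0 ≤ r < 1`,
`ℓ_r(v) = −∑_{m ≥ 1} r^m cos(m v)/m` (real part of `log (1 − z) = −∑ zᵐ/m`, `z = r e^{iv}`); the
`m = 0` term of the displayed family is `0`. [folklore] -/
theorem hasSum_circleLogKernelR {r : ℝ} (hr0 : 0 ≤ r) (hr1 : r < 1) (v : ℝ) :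
    HasSum (fun m : ℕ => -(r ^ m / m) * Real.cos (m * v)) (circleLogKernelR r v) := by
  set z : ℂ := (r : ℂ) * cexp (v * I) with hz
  have hzn : ‖z‖ < 1 := by
    simpa [hz, Complex.norm_exp_ofReal_mul_I, abs_of_nonneg hr0] using hr1
  have h := Complex.hasSum_taylorSeries_neg_log hzn
  have h2 : HasSum (fun m : ℕ => (z ^ m / m).re) (-Complex.log (1 - z)).re :=
    Complex.hasSum_re h
  have hre : (-Complex.log (1 - z)).re = -circleLogKernelR r v := by
    rw [neg_re, Complex.log_re, circleLogKernelR]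
  rw [hre] at h2
  have key : (fun m : ℕ => -(r ^ m / m) * Real.cos (m * v)) =
      fun m : ℕ => -((z ^ m / (m : ℂ)).re) := by
    ext m
    have hzm : z ^ m = (r ^ m : ℝ) * cexp ((m * v : ℝ) * I) := by
      rw [hz, mul_pow, ← Complex.exp_nat_mul]
      push_cast; ring_nf
    rw [hzm, Complex.div_natCast_re, Complex.re_ofReal_mul, Complex.exp_ofReal_mul_I_re]
    ring
  rw [key]
  simpa using h2.neg

/-! ### Symmetry, periodicity, regularity -/

/-- `|1 − r e^{iv}| = √(1 − 2 r cos v + r²)`. [folklore] -/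
theorem norm_one_sub_mul_exp_eq_sqrt (r v : ℝ) :
    ‖1 - (r : ℂ) * cexp (v * I)‖ = Real.sqrt (1 - 2 * r * Real.cos v + r ^ 2) := by
  rw [← norm_one_sub_mul_exp_sq, Real.sqrt_sq (norm_nonneg _)]

/-- `ℓ_r` in closed form: `ℓ_r(v) = log √(1 − 2 r cos v + r²)`. [folklore] -/
theorem circleLogKernelR_eq (r v : ℝ) :
    circleLogKernelR r v = Real.log (Real.sqrt (1 - 2 * r * Real.cos v + r ^ 2)) := by
  rw [circleLogKernelR, norm_one_sub_mul_exp_eq_sqrt]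

/-- `ℓ` in closed form: `ℓ(v) = log √(2 − 2 cos v)` (`= log |2 sin (v/2)|`). [folklore] -/
theorem circleLogKernel_eq (v : ℝ) :
    circleLogKernel v = Real.log (Real.sqrt (2 - 2 * Real.cos v)) := by
  rw [← circleLogKernelR_one, circleLogKernelR_eq]; ring_nf

/-- `ℓ_r` is even. [folklore] -/
@[simp] theorem circleLogKernelR_neg (r v : ℝ) : circleLogKernelR r (-v) = circleLogKernelR r v := by
  rw [circleLogKernelR_eq, circleLogKernelR_eq, Real.cos_neg]

/-- `ℓ` is even. [folklore] -/
@[simp] theorem circleLogKernel_neg (v : ℝ) : circleLogKernel (-v) = circleLogKernel v := by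
  rw [← circleLogKernelR_one, circleLogKernelR_neg]

/-- `ℓ(s − t) = ℓ(t − s)`. [folklore] -/
theorem circleLogKernel_sub_comm (s t : ℝ) : circleLogKernel (s - t) = circleLogKernel (t - s) := by
  rw [← circleLogKernel_neg, neg_sub]

/-- `ℓ_r(s − t) = ℓ_r(t − s)`. [folklore] -/
theorem circleLogKernelR_sub_comm (r s t : ℝ) :
    circleLogKernelR r (s - t) = circleLogKernelR r (t - s) := by
  rw [← circleLogKernelR_neg, neg_sub]

/-- `ℓ_r` is `2π`-periodic. [folklore] -/
theorem periodic_circleLogKernelR (r : ℝ) : Function.Periodic (circleLogKernelR r) (2 * π) := by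
  intro v; rw [circleLogKernelR_eq, circleLogKernelR_eq, Real.cos_add_two_pi]

/-- `ℓ` is `2π`-periodic. [folklore] -/
theorem periodic_circleLogKernel : Function.Periodic circleLogKernel (2 * π) := by
  rw [← circleLogKernelR_one]; exact periodic_circleLogKernelR 1

/-- The map `v ↦ 1 − r e^{iv}` is continuous. [folklore] -/
theorem continuous_one_sub_mul_exp (r : ℝ) : Continuous fun v : ℝ => 1 - (r : ℂ) * cexp (v * I) := by
  fun_prop

/-- For `0 ≤ r < 1`, `ℓ_r` is continuous. [folklore] -/
theorem continuous_circleLogKernelR {r : ℝ} (hr0 : 0 ≤ r) (hr1 : r < 1) :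
    Continuous (circleLogKernelR r) := by
  unfold circleLogKernelR
  refine ((continuous_one_sub_mul_exp r).norm).log fun v => ?_
  exact (lt_of_lt_of_le (by linarith) (one_sub_le_norm_one_sub_mul_exp hr0 v)).ne'

/-- `ℓ_r` is measurable (every `r`). [folklore] -/
@[fun_prop] theorem measurable_circleLogKernelR (r : ℝ) : Measurable (circleLogKernelR r) :=
  Real.measurable_log.comp (continuous_one_sub_mul_exp r).norm.measurable

/-- `ℓ` is measurable. [folklore] -/
@[fun_prop] theorem measurable_circleLogKernel : Measurable circleLogKernel := by
  rw [← circleLogKernelR_one]; exact measurable_circleLogKernelR 1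

/-- As `r → 1`, `ℓ_r(v) → ℓ(v)` at every `v ∉ 2πℤ`. [folklore] -/
theorem tendsto_circleLogKernelR {v : ℝ} (hv : cexp (v * I) ≠ 1) :
    Tendsto (fun r : ℝ => circleLogKernelR r v) (𝓝 1) (𝓝 (circleLogKernel v)) := by
  have hc : Continuous fun r : ℝ => ‖1 - (r : ℂ) * cexp (v * I)‖ := by fun_prop
  have h1 : ‖1 - ((1 : ℝ) : ℂ) * cexp (v * I)‖ ≠ 0 := by
    push_cast; rw [one_mul]; exact (norm_one_sub_exp_pos hv).ne'
  have := ((hc.tendsto 1).log h1)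
  rw [← circleLogKernelR_one]
  exact this

/-- The exceptional set `2πℤ` (where `e^{iv} = 1`) is countable. [folklore] -/
theorem countable_setOf_exp_mul_I_eq_one : {v : ℝ | cexp (v * I) = 1}.Countable := by
  have : {v : ℝ | cexp (v * I) = 1} = Set.range fun m : ℤ => 2 * π * m := by
    ext v; simp [exp_mul_I_eq_one_iff, eq_comm]
  rw [this]; exact Set.countable_range _

/-- Lebesgue-almost every `v` has `e^{iv} ≠ 1`. [folklore] -/
theorem ae_exp_mul_I_ne_one : ∀ᵐ v : ℝ, cexp (v * I) ≠ 1 :=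
  countable_setOf_exp_mul_I_eq_one.ae_notMem volume

/-! ### Integrability -/

/-- `v ↦ 1 − r e^{i(v − c)}` is real-analytic, hence meromorphic, on every interval. [folklore] -/
theorem meromorphicOn_one_sub_mul_exp (r c : ℝ) (S : Set ℝ) :
    MeromorphicOn (fun v : ℝ => 1 - (r : ℂ) * cexp (((v - c : ℝ) : ℂ) * I)) S := fun v _ => by
  apply AnalyticAt.meromorphicAt
  apply analyticAt_const.sub
  apply analyticAt_const.mul
  refine (analyticAt_cexp.restrictScalars (𝕜 := ℝ)).comp ?_
  exact ((Complex.ofRealCLM.analyticAt _).comp ((analyticAt_id).sub analyticAt_const)).mul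
    analyticAt_const

/-- `v ↦ ℓ_r(v − c)` is integrable on every bounded interval (log-norm of a meromorphic
function, Mathlib's `MeromorphicOn.intervalIntegrable_log_norm`). [folklore] -/
theorem intervalIntegrable_circleLogKernelR_sub (r c a b : ℝ) :
    IntervalIntegrable (fun v => circleLogKernelR r (v - c)) volume a b :=
  (meromorphicOn_one_sub_mul_exp r c _).intervalIntegrable_log_norm

/-- `v ↦ ℓ(v − c)` is integrable on every bounded interval. [folklore] -/
theorem intervalIntegrable_circleLogKernel_sub (c a b : ℝ) :
    IntervalIntegrable (fun v => circleLogKernel (v - c)) volume a b := by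
  simpa using intervalIntegrable_circleLogKernelR_sub 1 c a b

/-- `v ↦ ℓ(c − v)` is integrable on every bounded interval. [folklore] -/
theorem intervalIntegrable_circleLogKernel_sub' (c a b : ℝ) :
    IntervalIntegrable (fun v => circleLogKernel (c - v)) volume a b := by
  simpa only [circleLogKernel_sub_comm c] using intervalIntegrable_circleLogKernel_sub c a b

/-- `ℓ` is integrable on every bounded interval. [folklore] -/
theorem intervalIntegrable_circleLogKernel (a b : ℝ) :
    IntervalIntegrable circleLogKernel volume a b := by
  simpa using intervalIntegrable_circleLogKernel_sub 0 a b

/-- `ℓ_r` is integrable on every bounded interval. [folklore] -/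
theorem intervalIntegrable_circleLogKernelR (r a b : ℝ) :
    IntervalIntegrable (circleLogKernelR r) volume a b := by
  simpa using intervalIntegrable_circleLogKernelR_sub r 0 a b

/-! ### Trigonometric integrals over a period -/

/-- `∫_{-π}^{π} cos (k v) dv = 0` for a natural number `k ≥ 1`. [folklore] -/
theorem integral_cos_nat_mul {k : ℕ} (hk : k ≠ 0) :
    ∫ v in (-π)..π, Real.cos (k * v) = 0 := by
  have hk' : (k : ℝ) ≠ 0 := Nat.cast_ne_zero.2 hk
  have hd : ∀ x ∈ uIcc (-π) π, HasDerivAt (fun v => Real.sin (k * v) / k) (Real.cos (k * x)) x := by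
    intro x _
    have h1 : HasDerivAt (fun v : ℝ => (k : ℝ) * v) (k : ℝ) x := by
      simpa using (hasDerivAt_id x).const_mul (k : ℝ)
    have h3 := ((Real.hasDerivAt_sin ((k : ℝ) * x)).comp x h1).div_const (k : ℝ)
    refine h3.congr_deriv ?_
    rw [mul_div_assoc, div_self hk', mul_one]
  rw [integral_eq_sub_of_hasDerivAt hd (by apply Continuous.intervalIntegrable; fun_prop)]
  simp [Real.sin_nat_mul_pi, Real.sin_neg]

/-- `∫_{-π}^{π} cos (k v) cos v dv = π` if `k = 1` and `0` otherwise (`k ≥ 1`). [folklore] -/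
theorem integral_cos_nat_mul_mul_cos {k : ℕ} (hk : k ≠ 0) :
    ∫ v in (-π)..π, Real.cos (k * v) * Real.cos v = if k = 1 then π else 0 := by
  have hsum : ∀ v : ℝ, Real.cos (k * v) * Real.cos v =
      (Real.cos ((k + 1 : ℕ) * v) + Real.cos ((k - 1 : ℕ) * v)) / 2 := by
    intro v
    obtain ⟨j, rfl⟩ := Nat.exists_eq_succ_of_ne_zero hk
    have h1 : ((j.succ + 1 : ℕ) : ℝ) * v = j.succ * v + v := by push_cast; ring
    have h2 : ((j.succ - 1 : ℕ) : ℝ) * v = j.succ * v - v := by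
      rw [Nat.succ_sub_one]; push_cast; ring
    rw [h1, h2, Real.cos_add, Real.cos_sub]; ring
  simp_rw [hsum]
  rw [intervalIntegral.integral_div, intervalIntegral.integral_add
    (by apply Continuous.intervalIntegrable; fun_prop)
    (by apply Continuous.intervalIntegrable; fun_prop),
    integral_cos_nat_mul (Nat.succ_ne_zero k)]
  by_cases h1 : k = 1
  · subst h1; simp
  · rw [integral_cos_nat_mul (by omega), if_neg h1]; simp

/-- The integral of an odd function over `[-π, π]` vanishes. [folklore] -/
theorem integral_eq_zero_of_odd {f : ℝ → ℝ} (hf : ∀ v, f (-v) = -f v) :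
    ∫ v in (-π)..π, f v = 0 := by
  have h := intervalIntegral.integral_comp_neg (a := -π) (b := π) (f := f)
  simp only [neg_neg] at h
  simp_rw [hf, intervalIntegral.integral_neg] at h
  linarith

/-! ### Fourier moments of the regularised kernel -/

/-- Termwise integration of the Fourier expansion of `ℓ_r` against a bounded continuous weight
`g` (`|g| ≤ 1`): `∫_{-π}^{π} ℓ_r g = ∑_m −(rᵐ/m) ∫ cos(m v) g(v) dv`. [folklore] -/
theorem hasSum_integral_circleLogKernelR_mul {r : ℝ} (hr0 : 0 ≤ r) (hr1 : r < 1) {g : ℝ → ℝ}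
    (hg : Continuous g) (hg1 : ∀ v, |g v| ≤ 1) :
    HasSum (fun m : ℕ => ∫ v in (-π)..π, -(r ^ m / m) * Real.cos (m * v) * g v)
      (∫ v in (-π)..π, circleLogKernelR r v * g v) := by
  refine intervalIntegral.hasSum_integral_of_dominated_convergence (fun m _ => r ^ m)
    (fun m => (Continuous.aestronglyMeasurable (by fun_prop)))
    (fun m => ae_of_all _ fun v _ => ?_) (ae_of_all _ fun v _ => ?_) ?_
    (ae_of_all _ fun v _ => (hasSum_circleLogKernelR hr0 hr1 v).mul_right (g v))
  · rw [Real.norm_eq_abs, abs_mul, abs_mul, abs_neg]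
    have hcos : |Real.cos (m * v)| ≤ 1 := Real.abs_cos_le_one _
    have hcoef : |r ^ m / m| ≤ r ^ m := by
      rw [abs_of_nonneg (by positivity)]
      rcases Nat.eq_zero_or_pos m with rfl | hm
      · simp
      · exact div_le_self (by positivity) (by exact_mod_cast hm)
    calc |r ^ m / ↑m| * |Real.cos (↑m * v)| * |g v| ≤ r ^ m * 1 * 1 := by
          gcongr; exact hg1 v
      _ = r ^ m := by ring
  · exact summable_geometric_of_lt_one hr0 hr1
  · exact intervalIntegrable_const

/-- `∫_{-π}^{π} ℓ_r = 0` for `0 ≤ r < 1` (the mean of `log |1 − r e^{iv}|` vanishes). [folklore] -/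
theorem integral_circleLogKernelR {r : ℝ} (hr0 : 0 ≤ r) (hr1 : r < 1) :
    ∫ v in (-π)..π, circleLogKernelR r v = 0 := by
  have h := hasSum_integral_circleLogKernelR_mul hr0 hr1 continuous_const (g := fun _ => 1)
    (fun _ => by simp)
  simp only [mul_one] at h
  have h0 : (fun m : ℕ => ∫ v in (-π)..π, -(r ^ m / m) * Real.cos (m * v)) = fun _ => 0 := by
    ext m
    rcases Nat.eq_zero_or_pos m with rfl | hm
    · simp
    · rw [intervalIntegral.integral_const_mul, integral_cos_nat_mul hm.ne', mul_zero]
  rw [h0] at h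
  exact (hasSum_zero.unique h).symm

/-- `∫_{-π}^{π} ℓ_r(v) cos v dv = −π r` for `0 ≤ r < 1` (first Fourier coefficient). [folklore] -/
theorem integral_circleLogKernelR_mul_cos {r : ℝ} (hr0 : 0 ≤ r) (hr1 : r < 1) :
    ∫ v in (-π)..π, circleLogKernelR r v * Real.cos v = -π * r := by
  have h := hasSum_integral_circleLogKernelR_mul hr0 hr1 Real.continuous_cos Real.abs_cos_le_one
  have h0 : (fun m : ℕ => ∫ v in (-π)..π, -(r ^ m / m) * Real.cos (m * v) * Real.cos v) =
      fun m => if m = 1 then -π * r else 0 := by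
    ext m
    rcases Nat.eq_zero_or_pos m with rfl | hm
    · simp
    · simp_rw [mul_assoc]
      rw [intervalIntegral.integral_const_mul, integral_cos_nat_mul_mul_cos hm.ne']
      by_cases h1 : m = 1
      · subst h1; simp [mul_comm]
      · simp [h1]
  rw [h0] at h
  exact ((hasSum_ite_eq 1 (-π * r)).unique h).symm

/-- `∫_{-π}^{π} ℓ_r(v) sin v dv = 0` (odd integrand). [folklore] -/
theorem integral_circleLogKernelR_mul_sin (r : ℝ) :
    ∫ v in (-π)..π, circleLogKernelR r v * Real.sin v = 0 :=
  integral_eq_zero_of_odd fun v => by simp [Real.sin_neg]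

/-! ### Fourier moments of the kernel itself (`r → 1`) -/

/-- Dominated convergence as `r ↑ 1`: `∫ ℓ_r g → ∫ ℓ g` for a continuous weight with `|g| ≤ 1`.
[folklore] -/
theorem tendsto_integral_circleLogKernelR_mul {g : ℝ → ℝ} (hg : Continuous g)
    (hg1 : ∀ v, |g v| ≤ 1) :
    Tendsto (fun r => ∫ v in (-π)..π, circleLogKernelR r v * g v) (𝓝[<] 1)
      (𝓝 (∫ v in (-π)..π, circleLogKernel v * g v)) := by
  have hr : ∀ᶠ r : ℝ in 𝓝[<] 1, 1 / 4 < r ∧ r < 1 := by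
    have h1 : ∀ᶠ r : ℝ in 𝓝[<] 1, r < 1 := self_mem_nhdsWithin
    have h2 : ∀ᶠ r : ℝ in 𝓝[<] 1, 1 / 4 < r :=
      nhdsWithin_le_nhds (Ioi_mem_nhds (by norm_num : (1 : ℝ) / 4 < 1))
    exact h2.and h1
  refine intervalIntegral.tendsto_integral_filter_of_dominated_convergence
    (fun v => |circleLogKernel v| + Real.log 2) ?_ ?_ ?_ ?_
  · exact Eventually.of_forall fun r => (Measurable.aestronglyMeasurable (by fun_prop))
  · filter_upwards [hr] with r hr
    filter_upwards [ae_exp_mul_I_ne_one] with v hv _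
    have hup := circleLogKernelR_le_log_two (by linarith) hr.2.le v
    have hlow := circleLogKernel_add_le (by linarith) hv (r := r)
    have hlr : -(2 * Real.log 2) ≤ Real.log r := by
      rw [show (2 : ℝ) * Real.log 2 = Real.log 4 by
        rw [show (4 : ℝ) = 2 ^ 2 by norm_num, Real.log_pow]; norm_num, ← Real.log_inv]
      exact Real.log_le_log (by norm_num) (by rw [inv_eq_one_div]; exact hr.1.le)
    rw [Real.norm_eq_abs, abs_mul]
    calc |circleLogKernelR r v| * |g v| ≤ |circleLogKernelR r v| * 1 := by gcongr; exact hg1 v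
      _ ≤ |circleLogKernel v| + Real.log 2 := by
        rw [mul_one, abs_le]
        constructor
        · have := neg_abs_le (circleLogKernel v); linarith
        · have := abs_nonneg (circleLogKernel v); linarith
  · exact ((intervalIntegrable_circleLogKernel _ _).norm).add intervalIntegrable_const
  · filter_upwards [ae_exp_mul_I_ne_one] with v hv _
    exact ((tendsto_circleLogKernelR hv).mono_left nhdsWithin_le_nhds).mul_const (g v)

/-- **`∫_{-π}^{π} log |1 − e^{iv}| dv = 0`** (zeroth Fourier coefficient of the kernel;
equivalently `∫_0^π log sin = −π log 2`). [folklore] -/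
theorem integral_circleLogKernel : ∫ v in (-π)..π, circleLogKernel v = 0 := by
  have h := tendsto_integral_circleLogKernelR_mul continuous_const (g := fun _ => 1)
    (fun _ => by simp)
  simp only [mul_one] at h
  have h' : Tendsto (fun r : ℝ => ∫ v in (-π)..π, circleLogKernelR r v) (𝓝[<] 1) (𝓝 0) := by
    apply tendsto_const_nhds.congr'
    have h1 : ∀ᶠ r : ℝ in 𝓝[<] 1, r < 1 := self_mem_nhdsWithin
    have h2 : ∀ᶠ r : ℝ in 𝓝[<] 1, 0 < r := nhdsWithin_le_nhds (Ioi_mem_nhds one_pos)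
    filter_upwards [h1, h2] with r h1 h2
    exact (integral_circleLogKernelR h2.le h1).symm
  exact tendsto_nhds_unique h h'

/-- **`∫_{-π}^{π} log |1 − e^{iv}| cos v dv = −π`** (first Fourier coefficient of the kernel:
`log |1 − e^{iv}| ∼ −∑_{m ≥ 1} cos (m v)/m`). [folklore] -/
theorem integral_circleLogKernel_mul_cos : ∫ v in (-π)..π, circleLogKernel v * Real.cos v = -π := by
  have h := tendsto_integral_circleLogKernelR_mul Real.continuous_cos Real.abs_cos_le_one
  have h' : Tendsto (fun r : ℝ => ∫ v in (-π)..π, circleLogKernelR r v * Real.cos v) (𝓝[<] 1)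
      (𝓝 (-π)) := by
    have hc : Tendsto (fun r : ℝ => -π * r) (𝓝[<] 1) (𝓝 (-π)) := by
      have : Tendsto (fun r : ℝ => -π * r) (𝓝 1) (𝓝 (-π * 1)) :=
        (continuous_const.mul continuous_id).tendsto 1
      rw [mul_one] at this
      exact this.mono_left nhdsWithin_le_nhds
    apply hc.congr'
    have h1 : ∀ᶠ r : ℝ in 𝓝[<] 1, r < 1 := self_mem_nhdsWithin
    have h2 : ∀ᶠ r : ℝ in 𝓝[<] 1, 0 < r := nhdsWithin_le_nhds (Ioi_mem_nhds one_pos)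
    filter_upwards [h1, h2] with r h1 h2
    exact (integral_circleLogKernelR_mul_cos h2.le h1).symm
  exact tendsto_nhds_unique h h'

/-- `∫_{-π}^{π} log |1 − e^{iv}| sin v dv = 0` (odd integrand). [folklore] -/
theorem integral_circleLogKernel_mul_sin : ∫ v in (-π)..π, circleLogKernel v * Real.sin v = 0 :=
  integral_eq_zero_of_odd fun v => by simp [Real.sin_neg]


/-! ### Logarithmic potentials and energies of finite measures on a period -/

section Measures

variable (μ ν : Measure ℝ)

/-- The **logarithmic potential** of a finite measure `μ` on `ℝ` (angles) for the circle kernel: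
`U^μ(t) = ∫ ℓ(t − s) dμ(s) = ∫ log |e^{it} − e^{is}| dμ(s)`. [folklore] -/
def circleLogPotential (t : ℝ) : ℝ := ∫ s, circleLogKernel (t - s) ∂μ

/-- The **regularised logarithmic potential** `U_r^μ(t) = ∫ ℓ_r(t − s) dμ(s)`
`= ∫ log |r e^{it} − e^{is}| dμ(s)` (the potential of `μ` at the interior point `r e^{it}`).
[folklore] -/
def circleLogPotentialR (r t : ℝ) : ℝ := ∫ s, circleLogKernelR r (t - s) ∂μ

/-- The **logarithmic energy** `E(μ) = ∫∫ log |e^{it} − e^{is}| dμ(s) dμ(t) = ∫ U^μ dμ` (as an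
iterated integral). [folklore] -/
def circleLogEnergy : ℝ := ∫ t, circleLogPotential μ t ∂μ

/-- The **regularised mutual energy** `E_r(μ, ν) = ∫∫ ℓ_r(t − s) dν(s) dμ(t) = ∫ U_r^ν dμ`.
[folklore] -/
def circleLogEnergyR (r : ℝ) : ℝ := ∫ t, circleLogPotentialR ν r t ∂μ

/-- The `m`-th cosine moment `∫ cos (m s) dμ(s)`. [folklore] -/
def cosMoment (m : ℕ) : ℝ := ∫ s, Real.cos (m * s) ∂μ

/-- The `m`-th sine moment `∫ sin (m s) dμ(s)`. [folklore] -/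
def sinMoment (m : ℕ) : ℝ := ∫ s, Real.sin (m * s) ∂μ

variable {μ ν}

/-- A bounded measurable real function is integrable against a finite measure. [folklore] -/
theorem integrable_of_abs_le [IsFiniteMeasure μ] {f : ℝ → ℝ} (hf : Measurable f) {C : ℝ}
    (hC : ∀ x, |f x| ≤ C) : Integrable f μ :=
  (integrable_const C).mono' hf.aestronglyMeasurable (ae_of_all _ fun x => by
    rw [Real.norm_eq_abs]; exact hC x)

/-- `|cosMoment μ m| ≤ μ(ℝ)`. [folklore] -/
theorem abs_cosMoment_le [IsFiniteMeasure μ] (m : ℕ) : |cosMoment μ m| ≤ μ.real univ := by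
  have h := norm_integral_le_of_norm_le_const (μ := μ) (f := fun s : ℝ => Real.cos (m * s)) (C := 1)
    (ae_of_all _ fun s => by rw [Real.norm_eq_abs]; exact Real.abs_cos_le_one _)
  simpa [cosMoment] using h

/-- `|sinMoment μ m| ≤ μ(ℝ)`. [folklore] -/
theorem abs_sinMoment_le [IsFiniteMeasure μ] (m : ℕ) : |sinMoment μ m| ≤ μ.real univ := by
  have h := norm_integral_le_of_norm_le_const (μ := μ) (f := fun s : ℝ => Real.sin (m * s)) (C := 1)
    (ae_of_all _ fun s => by rw [Real.norm_eq_abs]; exact Real.abs_sin_le_one _)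
  simpa [sinMoment] using h

/-- **Fourier expansion of the regularised potential.** For a finite measure `μ` and `0 ≤ r < 1`,
`U_r^μ(t) = −∑_m (rᵐ/m) (cos (m t) ∫cos (m s) dμ + sin (m t) ∫ sin (m s) dμ)`. [folklore] -/
theorem hasSum_circleLogPotentialR [IsFiniteMeasure μ] {r : ℝ} (hr0 : 0 ≤ r) (hr1 : r < 1)
    (t : ℝ) :
    HasSum (fun m : ℕ => -(r ^ m / m) *
      (Real.cos (m * t) * cosMoment μ m + Real.sin (m * t) * sinMoment μ m))
      (circleLogPotentialR μ r t) := by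
  set F : ℕ → ℝ → ℝ := fun m s => -(r ^ m / m) * Real.cos (m * (t - s)) with hF
  have hcoef : ∀ m : ℕ, |r ^ m / m| ≤ r ^ m := fun m => by
    rw [abs_of_nonneg (by positivity)]
    rcases Nat.eq_zero_or_pos m with rfl | hm
    · simp
    · exact div_le_self (by positivity) (by exact_mod_cast hm)
  have hFb : ∀ m s, |F m s| ≤ r ^ m := fun m s => by
    rw [hF]; dsimp only
    rw [abs_mul, abs_neg]
    calc |r ^ m / ↑m| * |Real.cos (↑m * (t - s))| ≤ r ^ m * 1 := by
          gcongr
          · exact hcoef m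
          · exact Real.abs_cos_le_one _
      _ = r ^ m := mul_one _
  have hFi : ∀ m, Integrable (F m) μ := fun m =>
    integrable_of_abs_le (by rw [hF]; fun_prop) (hFb m)
  have hsum : Summable fun m => ∫ s, ‖F m s‖ ∂μ := by
    refine Summable.of_nonneg_of_le (fun m => integral_nonneg fun s => norm_nonneg _)
      (fun m => ?_) ((summable_geometric_of_lt_one hr0 hr1).mul_right (μ.real univ))
    have := norm_integral_le_of_norm_le_const (μ := μ) (f := fun s => ‖F m s‖) (C := r ^ m)
      (ae_of_all _ fun s => by rw [norm_norm, Real.norm_eq_abs]; exact hFb m s)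
    rw [Real.norm_eq_abs, abs_of_nonneg (integral_nonneg fun s => norm_nonneg _)] at this
    exact this
  have h := hasSum_integral_of_summable_integral_norm hFi hsum
  have hlim : (fun s => ∑' m, F m s) = fun s => circleLogKernelR r (t - s) := by
    ext s; exact (hasSum_circleLogKernelR hr0 hr1 (t - s)).tsum_eq
  rw [hlim] at h
  refine h.congr_fun fun m => ?_
  rw [hF]; dsimp only
  have : ∀ s, -(r ^ m / ↑m) * Real.cos (↑m * (t - s)) =
      -(r ^ m / ↑m) * Real.cos (m * t) * Real.cos (m * s) +
        -(r ^ m / ↑m) * Real.sin (m * t) * Real.sin (m * s) := fun s => by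
    rw [mul_sub, Real.cos_sub]; ring
  simp_rw [this]
  rw [MeasureTheory.integral_add, MeasureTheory.integral_const_mul,
    MeasureTheory.integral_const_mul, cosMoment, sinMoment]
  · ring
  · exact (integrable_of_abs_le (by fun_prop) (fun s => Real.abs_cos_le_one (m * s))).const_mul _
  · exact (integrable_of_abs_le (by fun_prop) (fun s => Real.abs_sin_le_one (m * s))).const_mul _

/-- The regularised potential of a finite measure is bounded: `|U_r^μ| ≤ (log 2 − log (1−r)) μ(ℝ)`.
[folklore] -/
theorem abs_circleLogPotentialR_le [IsFiniteMeasure μ] {r : ℝ} (hr0 : 0 ≤ r) (hr1 : r < 1)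
    (t : ℝ) : |circleLogPotentialR μ r t| ≤ (Real.log 2 - Real.log (1 - r)) * μ.real univ := by
  have h := norm_integral_le_of_norm_le_const (μ := μ)
    (f := fun s : ℝ => circleLogKernelR r (t - s)) (C := Real.log 2 - Real.log (1 - r))
    (ae_of_all _ fun s => by rw [Real.norm_eq_abs]; exact abs_circleLogKernelR_le hr0 hr1 _)
  simpa [circleLogPotentialR] using h

/-- The regularised potential is measurable in the evaluation point. [folklore] -/
@[fun_prop] theorem measurable_circleLogPotentialR [SFinite μ] (r : ℝ) :
    Measurable (circleLogPotentialR μ r) := by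
  have : StronglyMeasurable (Function.uncurry fun (t s : ℝ) => circleLogKernelR r (t - s)) :=
    (Measurable.stronglyMeasurable (by fun_prop))
  exact (this.integral_prod_right (ν := μ)).measurable

/-- The potential is measurable in the evaluation point. [folklore] -/
@[fun_prop] theorem measurable_circleLogPotential [SFinite μ] :
    Measurable (circleLogPotential μ) := by
  have : StronglyMeasurable (Function.uncurry fun (t s : ℝ) => circleLogKernel (t - s)) :=
    (Measurable.stronglyMeasurable (by fun_prop))
  exact (this.integral_prod_right (ν := μ)).measurable

/-- **Fourier expansion of the regularised mutual energy.** For finite measures `μ, ν` and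
`0 ≤ r < 1`, `E_r(μ,ν) = −∑_m (rᵐ/m) (C_m(μ) C_m(ν) + S_m(μ) S_m(ν))` with `C_m, S_m` the cosine
and sine moments. [folklore] -/
theorem hasSum_circleLogEnergyR [IsFiniteMeasure μ] [IsFiniteMeasure ν] {r : ℝ} (hr0 : 0 ≤ r)
    (hr1 : r < 1) :
    HasSum (fun m : ℕ => -(r ^ m / m) *
      (cosMoment μ m * cosMoment ν m + sinMoment μ m * sinMoment ν m))
      (circleLogEnergyR μ ν r) := by
  set G : ℕ → ℝ → ℝ := fun m t => -(r ^ m / m) *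
      (Real.cos (m * t) * cosMoment ν m + Real.sin (m * t) * sinMoment ν m) with hG
  have hcoef : ∀ m : ℕ, |r ^ m / m| ≤ r ^ m := fun m => by
    rw [abs_of_nonneg (by positivity)]
    rcases Nat.eq_zero_or_pos m with rfl | hm
    · simp
    · exact div_le_self (by positivity) (by exact_mod_cast hm)
  have hGb : ∀ m t, |G m t| ≤ r ^ m * (2 * ν.real univ) := fun m t => by
    have h1 : |Real.cos (m * t) * cosMoment ν m| ≤ ν.real univ := by
      rw [abs_mul]
      exact (mul_le_mul (Real.abs_cos_le_one _) (abs_cosMoment_le m) (abs_nonneg _)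
        zero_le_one).trans_eq (one_mul _)
    have h2 : |Real.sin (m * t) * sinMoment ν m| ≤ ν.real univ := by
      rw [abs_mul]
      exact (mul_le_mul (Real.abs_sin_le_one _) (abs_sinMoment_le m) (abs_nonneg _)
        zero_le_one).trans_eq (one_mul _)
    have h3 := abs_add_le (Real.cos (m * t) * cosMoment ν m) (Real.sin (m * t) * sinMoment ν m)
    rw [hG]; dsimp only
    rw [abs_mul, abs_neg]
    exact mul_le_mul (hcoef m) (by linarith) (abs_nonneg _) (by positivity)
  have hGi : ∀ m, Integrable (G m) μ := fun m =>
    integrable_of_abs_le (by rw [hG]; fun_prop) (hGb m)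
  have hsum : Summable fun m => ∫ t, ‖G m t‖ ∂μ := by
    refine Summable.of_nonneg_of_le (fun m => integral_nonneg fun s => norm_nonneg _)
      (fun m => ?_)
      (((summable_geometric_of_lt_one hr0 hr1).mul_right (2 * ν.real univ)).mul_right
        (μ.real univ))
    have := norm_integral_le_of_norm_le_const (μ := μ) (f := fun t => ‖G m t‖)
      (C := r ^ m * (2 * ν.real univ))
      (ae_of_all _ fun t => by rw [norm_norm, Real.norm_eq_abs]; exact hGb m t)
    rw [Real.norm_eq_abs, abs_of_nonneg (integral_nonneg fun s => norm_nonneg _)] at this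
    exact this
  have h := hasSum_integral_of_summable_integral_norm hGi hsum
  have hlim : (fun t => ∑' m, G m t) = fun t => circleLogPotentialR ν r t := by
    ext t; exact (hasSum_circleLogPotentialR hr0 hr1 t).tsum_eq
  rw [hlim] at h
  refine h.congr_fun fun m => ?_
  rw [hG]; dsimp only
  have : ∀ t, -(r ^ m / ↑m) * (Real.cos (↑m * t) * cosMoment ν m + Real.sin (↑m * t) * sinMoment ν m)
      = -(r ^ m / ↑m) * cosMoment ν m * Real.cos (m * t) +
        -(r ^ m / ↑m) * sinMoment ν m * Real.sin (m * t) := fun t => by ring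
  simp_rw [this]
  rw [MeasureTheory.integral_add, MeasureTheory.integral_const_mul,
    MeasureTheory.integral_const_mul]
  · rw [cosMoment, sinMoment, cosMoment, sinMoment]; ring
  · exact (integrable_of_abs_le (by fun_prop) (fun s => Real.abs_cos_le_one (m * s))).const_mul _
  · exact (integrable_of_abs_le (by fun_prop) (fun s => Real.abs_sin_le_one (m * s))).const_mul _

/-- **The regularised logarithmic kernel is of negative type (L3).** For finite measures `μ, ν`
on `ℝ` and `0 ≤ r < 1`: `E_r(μ,μ) + E_r(ν,ν) ≤ 2 E_r(μ,ν)` — indeed the difference is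
`−∑_m (rᵐ/m) ((C_m(μ) − C_m(ν))² + (S_m(μ) − S_m(ν))²) ≤ 0`. No condition on the total masses is
needed (the constant Fourier mode of `ℓ_r` vanishes). [folklore] -/
theorem circleLogEnergyR_add_le [IsFiniteMeasure μ] [IsFiniteMeasure ν] {r : ℝ} (hr0 : 0 ≤ r)
    (hr1 : r < 1) :
    circleLogEnergyR μ μ r + circleLogEnergyR ν ν r ≤ 2 * circleLogEnergyR μ ν r := by
  have ha := hasSum_circleLogEnergyR (μ := μ) (ν := μ) hr0 hr1
  have hb := hasSum_circleLogEnergyR (μ := ν) (ν := ν) hr0 hr1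
  have hc := hasSum_circleLogEnergyR (μ := μ) (ν := ν) hr0 hr1
  have h := (ha.add hb).sub (hc.mul_left 2)
  have hle : circleLogEnergyR μ μ r + circleLogEnergyR ν ν r - 2 * circleLogEnergyR μ ν r ≤ 0 := by
    refine h.nonpos fun m => ?_
    have h1 : 0 ≤ r ^ m / m := by positivity
    have h2 : 0 ≤ (cosMoment μ m - cosMoment ν m) ^ 2 + (sinMoment μ m - sinMoment ν m) ^ 2 := by
      positivity
    nlinarith
  linarith

/-! ### Measures dominated by Lebesgue measure on a period -/

/-- For a measure dominated by a multiple of Lebesgue measure on `[-π, π]`, the shifted kernel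
`s ↦ ℓ(t − s)` is integrable. [folklore] -/
theorem integrable_circleLogKernel_sub {M : ℝ}
    (hμ : μ ≤ ENNReal.ofReal M • volume.restrict (Icc (-π) π)) (t : ℝ) :
    Integrable (fun s => circleLogKernel (t - s)) μ := by
  refine Integrable.of_measure_le_smul ENNReal.ofReal_ne_top hμ ?_
  have h := intervalIntegrable_circleLogKernel_sub' t (-π) π
  rw [intervalIntegrable_iff_integrableOn_Icc_of_le (by linarith [Real.pi_pos])] at h
  exact h

/-- Such a measure is finite: `μ(ℝ) ≤ 2π M`. [folklore] -/
theorem measureReal_univ_le_of_le_smul {M : ℝ} (hM : 0 ≤ M)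
    (hμ : μ ≤ ENNReal.ofReal M • volume.restrict (Icc (-π) π)) : μ.real univ ≤ M * (2 * π) := by
  have h := hμ univ
  simp only [Measure.smul_apply, Measure.restrict_apply MeasurableSet.univ, univ_inter,
    Real.volume_Icc, smul_eq_mul] at h
  rw [measureReal_def]
  have : M * (2 * π) = (ENNReal.ofReal M * ENNReal.ofReal (π - -π)).toReal := by
    rw [ENNReal.toReal_mul, ENNReal.toReal_ofReal hM, ENNReal.toReal_ofReal (by linarith [Real.pi_pos])]
    ring
  rw [this]
  exact ENNReal.toReal_mono (ENNReal.mul_ne_top ENNReal.ofReal_ne_top ENNReal.ofReal_ne_top) h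

/-- Such a measure is a finite measure. [folklore] -/
theorem isFiniteMeasure_of_le_smul {M : ℝ}
    (hμ : μ ≤ ENNReal.ofReal M • volume.restrict (Icc (-π) π)) : IsFiniteMeasure μ := by
  constructor
  have h := hμ univ
  refine lt_of_le_of_lt h ?_
  simp only [Measure.smul_apply, Measure.restrict_apply MeasurableSet.univ, univ_inter,
    Real.volume_Icc, smul_eq_mul]
  exact ENNReal.mul_lt_top ENNReal.ofReal_lt_top ENNReal.ofReal_lt_top

/-- Such a measure is absolutely continuous with respect to Lebesgue measure. [folklore] -/
theorem absolutelyContinuous_of_le_smul {M : ℝ}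
    (hμ : μ ≤ ENNReal.ofReal M • volume.restrict (Icc (-π) π)) : μ ≪ volume :=
  (Measure.absolutelyContinuous_of_le_smul hμ).trans Measure.restrict_le_self.absolutelyContinuous

/-- The potential of a dominated measure is bounded: `|U^μ(t)| ≤ M ∫_{-π}^{π} |ℓ|`. [folklore] -/
theorem abs_circleLogPotential_le {M : ℝ} (hM : 0 ≤ M)
    (hμ : μ ≤ ENNReal.ofReal M • volume.restrict (Icc (-π) π)) (t : ℝ) :
    |circleLogPotential μ t| ≤ M * ∫ v in (-π)..π, |circleLogKernel v| := by
  rw [circleLogPotential]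
  have h1 : |∫ s, circleLogKernel (t - s) ∂μ| ≤ ∫ s, |circleLogKernel (t - s)| ∂μ :=
    abs_integral_le_integral_abs
  have hint : IntegrableOn (fun s => |circleLogKernel (t - s)|) (Icc (-π) π) := by
    have h := (intervalIntegrable_circleLogKernel_sub' t (-π) π).norm
    rw [intervalIntegrable_iff_integrableOn_Icc_of_le (by linarith [Real.pi_pos])] at h
    simpa only [Real.norm_eq_abs] using h
  have h2 : ∫ s, |circleLogKernel (t - s)| ∂μ ≤
      ∫ s, |circleLogKernel (t - s)| ∂(ENNReal.ofReal M • volume.restrict (Icc (-π) π)) :=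
    integral_mono_measure hμ (ae_of_all _ fun s => abs_nonneg _)
      (Integrable.smul_measure hint ENNReal.ofReal_ne_top)
  rw [MeasureTheory.integral_smul_measure, ENNReal.toReal_ofReal hM, smul_eq_mul] at h2
  have h3 : ∫ s in Icc (-π) π, |circleLogKernel (t - s)| = ∫ v in (-π)..π, |circleLogKernel v| := by
    rw [integral_Icc_eq_integral_Ioc, ← intervalIntegral.integral_of_le (by linarith [Real.pi_pos]),
      intervalIntegral.integral_comp_sub_left (fun v => |circleLogKernel v|) t,
      show t - -π = (t - π) + 2 * π by ring]
    have hp : Function.Periodic (fun x => |circleLogKernel x|) (2 * π) := fun x => by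
      simp only [periodic_circleLogKernel x]
    rw [hp.intervalIntegral_add_eq (t - π) (-π), show -π + 2 * π = π by ring]
  rw [h3] at h2
  exact h1.trans h2

/-- The potential of a dominated measure is integrable against any finite measure. [folklore] -/
theorem integrable_circleLogPotential {M : ℝ} (hM : 0 ≤ M)
    (hμ : μ ≤ ENNReal.ofReal M • volume.restrict (Icc (-π) π)) (ν : Measure ℝ) [IsFiniteMeasure ν] :
    Integrable (circleLogPotential μ) ν := by
  haveI := isFiniteMeasure_of_le_smul hμ
  exact integrable_of_abs_le (measurable_circleLogPotential) (abs_circleLogPotential_le hM hμ)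

/-- The regularised potential of a finite measure is integrable against any finite measure.
[folklore] -/
theorem integrable_circleLogPotentialR [IsFiniteMeasure μ] {r : ℝ} (hr0 : 0 ≤ r) (hr1 : r < 1)
    (ν : Measure ℝ) [IsFiniteMeasure ν] : Integrable (circleLogPotentialR μ r) ν :=
  integrable_of_abs_le (measurable_circleLogPotentialR r) (abs_circleLogPotentialR_le hr0 hr1)

/-- For every `t`, Lebesgue-a.e. `s` has `e^{i(t−s)} ≠ 1`; hence `ν`-a.e. for `ν ≪ volume`.
[folklore] -/
theorem ae_exp_sub_ne_one (hν : ν ≪ volume) (t : ℝ) :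
    ∀ᵐ s ∂ν, cexp (((t - s : ℝ) : ℂ) * I) ≠ 1 := by
  apply hν.ae_le
  have hc : {s : ℝ | cexp (((t - s : ℝ) : ℂ) * I) = 1}.Countable := by
    have : {s : ℝ | cexp (((t - s : ℝ) : ℂ) * I) = 1} =
        (fun v => t - v) '' {v : ℝ | cexp ((v : ℂ) * I) = 1} := by
      ext s
      simp only [mem_setOf_eq, mem_image]
      constructor
      · intro h; exact ⟨t - s, h, by ring⟩
      · rintro ⟨v, hv, rfl⟩; simpa using hv
    rw [this]; exact countable_setOf_exp_mul_I_eq_one.image _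
  exact hc.ae_notMem volume

/-- **Energy comparison.** For a finite measure `μ ≪ Lebesgue` with integrable kernel (here:
dominated by a multiple of Lebesgue measure on a period) and `0 < r < 1`:
`E(μ) + (log r / 2) μ(ℝ)² ≤ E_r(μ, μ)` (integrate L1, which holds off a `μ ⊗ μ`-null set).
[folklore] -/
theorem circleLogEnergy_add_le_circleLogEnergyR {M : ℝ} (hM : 0 ≤ M)
    (hμ : μ ≤ ENNReal.ofReal M • volume.restrict (Icc (-π) π)) {r : ℝ} (hr0 : 0 < r) (hr1 : r < 1) :
    circleLogEnergy μ + Real.log r / 2 * μ.real univ ^ 2 ≤ circleLogEnergyR μ μ r := by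
  haveI := isFiniteMeasure_of_le_smul hμ
  have hν := absolutelyContinuous_of_le_smul hμ
  have hpt : ∀ t, circleLogPotential μ t + Real.log r / 2 * μ.real univ ≤ circleLogPotentialR μ r t := by
    intro t
    rw [circleLogPotential, circleLogPotentialR,
      show Real.log r / 2 * μ.real univ = ∫ _s, Real.log r / 2 ∂μ by
        rw [MeasureTheory.integral_const, smul_eq_mul]; ring,
      ← MeasureTheory.integral_add (integrable_circleLogKernel_sub hμ t) (integrable_const _)]
    refine integral_mono_ae ((integrable_circleLogKernel_sub hμ t).add (integrable_const _))
      (integrable_of_abs_le (by fun_prop) fun s => abs_circleLogKernelR_le hr0.le hr1 (t - s)) ?_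
    filter_upwards [ae_exp_sub_ne_one hν t] with s hs
    exact circleLogKernel_add_le hr0 hs
  rw [circleLogEnergy, circleLogEnergyR,
    show Real.log r / 2 * μ.real univ ^ 2 = ∫ _t, Real.log r / 2 * μ.real univ ∂μ by
      rw [MeasureTheory.integral_const, smul_eq_mul]; ring,
    ← MeasureTheory.integral_add (integrable_circleLogPotential hM hμ μ) (integrable_const _)]
  exact integral_mono ((integrable_circleLogPotential hM hμ μ).add (integrable_const _))
    (integrable_circleLogPotentialR hr0.le hr1 μ) hpt

/-! ### Smoothing: the regularised potential exceeds the potential by little -/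

/-- The **regularisation excess** `η(r) = ∫_{-π}^{π} (ℓ_r − ℓ)⁺`. [folklore] -/
def circleLogExcess (r : ℝ) : ℝ :=
  ∫ v in (-π)..π, max (circleLogKernelR r v - circleLogKernel v) 0

/-- `η(r) ≥ 0`. [folklore] -/
theorem circleLogExcess_nonneg (r : ℝ) : 0 ≤ circleLogExcess r :=
  intervalIntegral.integral_nonneg (by linarith [Real.pi_pos]) fun v _ => le_max_right _ _

/-- **`η(r) → 0` as `r ↑ 1`** (dominated convergence: `(ℓ_r − ℓ)⁺ → 0` off `2πℤ`, dominated by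
`log 2 + |ℓ|`). [folklore] -/
theorem tendsto_circleLogExcess : Tendsto circleLogExcess (𝓝[<] 1) (𝓝 0) := by
  have hr : ∀ᶠ r : ℝ in 𝓝[<] 1, 0 < r ∧ r < 1 := by
    have h1 : ∀ᶠ r : ℝ in 𝓝[<] 1, r < 1 := self_mem_nhdsWithin
    have h2 : ∀ᶠ r : ℝ in 𝓝[<] 1, 0 < r := nhdsWithin_le_nhds (Ioi_mem_nhds one_pos)
    exact h2.and h1
  have h0 : (∫ v in (-π)..π, max (circleLogKernel v - circleLogKernel v) 0) = 0 := by simp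
  rw [← h0]
  refine intervalIntegral.tendsto_integral_filter_of_dominated_convergence
    (fun v => |circleLogKernel v| + Real.log 2) ?_ ?_ ?_ ?_
  · exact Eventually.of_forall fun r => (Measurable.aestronglyMeasurable (by fun_prop))
  · filter_upwards [hr] with r hr
    filter_upwards with v _
    have hup := circleLogKernelR_le_log_two hr.1.le hr.2.le v
    rw [Real.norm_eq_abs, abs_of_nonneg (le_max_right _ _), max_le_iff]
    constructor
    · have := neg_abs_le (circleLogKernel v); linarith
    · have := abs_nonneg (circleLogKernel v); have := Real.log_nonneg one_le_two; linarith
  · exact ((intervalIntegrable_circleLogKernel _ _).norm).add intervalIntegrable_const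
  · filter_upwards [ae_exp_mul_I_ne_one] with v hv _
    have h : Tendsto (fun r => circleLogKernelR r v - circleLogKernel v) (𝓝[<] 1)
        (𝓝 (circleLogKernel v - circleLogKernel v)) :=
      ((tendsto_circleLogKernelR hv).mono_left nhdsWithin_le_nhds).sub_const (circleLogKernel v)
    rw [sub_self] at h
    simpa using h.max (tendsto_const_nhds (x := (0 : ℝ)))

/-- **Smoothing inequality (L4).** If `μ ≤ M · Lebesgue|[-π,π]` then for `0 < r < 1` and every `t`,
`U_r^μ(t) ≤ U^μ(t) + M η(r)`: pointwise `ℓ_r − ℓ ≤ (ℓ_r − ℓ)⁺`, and the integral of the periodic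
function `(ℓ_r − ℓ)⁺(t − ·)` against `μ` is at most `M` times its integral over a period. [folklore] -/
theorem circleLogPotentialR_le {M : ℝ} (hM : 0 ≤ M)
    (hμ : μ ≤ ENNReal.ofReal M • volume.restrict (Icc (-π) π)) {r : ℝ} (hr0 : 0 < r) (hr1 : r < 1)
    (t : ℝ) : circleLogPotentialR μ r t ≤ circleLogPotential μ t + M * circleLogExcess r := by
  haveI := isFiniteMeasure_of_le_smul hμ
  set F : ℝ → ℝ := fun v => max (circleLogKernelR r v - circleLogKernel v) 0 with hF
  have hFm : Measurable F := by rw [hF]; fun_prop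
  have hFp : Function.Periodic F (2 * π) := fun v => by
    simp only [hF, periodic_circleLogKernelR r v, periodic_circleLogKernel v]
  have hFi : ∀ a b, IntervalIntegrable F volume a b := fun a b => by
    refine ((intervalIntegrable_circleLogKernelR r a b).sub
      (intervalIntegrable_circleLogKernel a b)).norm.mono_fun' hFm.aestronglyMeasurable
      (ae_of_all _ fun v => ?_)
    rw [hF]; dsimp only
    rw [Real.norm_eq_abs, abs_of_nonneg (le_max_right _ _), Real.norm_eq_abs]
    exact max_le (le_abs_self _) (abs_nonneg _)
  -- integrability of `s ↦ F (t - s)` on the period, w.r.t. the dominating measure and w.r.t. `μ`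
  have hFti : Integrable (fun s => F (t - s)) (volume.restrict (Icc (-π) π)) := by
    have h := (hFi (t - -π) (t - π)).comp_sub_left t
    simp only [sub_sub_cancel] at h
    rw [intervalIntegrable_iff_integrableOn_Icc_of_le (by linarith [Real.pi_pos])] at h
    exact h
  have hFtμ : Integrable (fun s => F (t - s)) μ :=
    Integrable.of_measure_le_smul ENNReal.ofReal_ne_top hμ hFti
  have hKR : Integrable (fun s => circleLogKernelR r (t - s)) μ :=
    integrable_of_abs_le (by fun_prop) fun s => abs_circleLogKernelR_le hr0.le hr1 (t - s)
  have hK : Integrable (fun s => circleLogKernel (t - s)) μ := integrable_circleLogKernel_sub hμ t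
  -- step 1: U_r - U = ∫ (ℓ_r - ℓ)(t - s) dμ ≤ ∫ F (t - s) dμ
  have h1 : circleLogPotentialR μ r t - circleLogPotential μ t ≤ ∫ s, F (t - s) ∂μ := by
    rw [circleLogPotentialR, circleLogPotential, ← integral_sub hKR hK]
    exact integral_mono (hKR.sub hK) hFtμ fun s => le_max_left _ _
  -- step 2: ∫ F(t - s) dμ ≤ M ∫_{Icc} F (t - s) ds
  have h2 : ∫ s, F (t - s) ∂μ ≤ M * ∫ s in Icc (-π) π, F (t - s) := by
    have := integral_mono_measure hμ (ae_of_all _ fun s => le_max_right _ _)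
      (hFti.smul_measure ENNReal.ofReal_ne_top)
    rwa [MeasureTheory.integral_smul_measure, ENNReal.toReal_ofReal hM, smul_eq_mul] at this
  -- step 3: the period integral equals η(r)
  have h3 : ∫ s in Icc (-π) π, F (t - s) = circleLogExcess r := by
    rw [integral_Icc_eq_integral_Ioc, ← intervalIntegral.integral_of_le (by linarith [Real.pi_pos]),
      intervalIntegral.integral_comp_sub_left F t, show t - -π = (t - π) + 2 * π by ring,
      hFp.intervalIntegral_add_eq (t - π) (-π), show -π + 2 * π = π by ring, circleLogExcess]
  rw [h3] at h2
  linarith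

end Measures

/-! ### Kernel identities used for explicit potentials -/

/-- `|1 − e^{i(x−y)}| · |1 − e^{i(x+y)}| = 2 |cos x − cos y|`. [folklore] -/
theorem norm_one_sub_exp_sub_mul_norm_one_sub_exp_add (x y : ℝ) :
    ‖1 - cexp (((x - y : ℝ) : ℂ) * I)‖ * ‖1 - cexp (((x + y : ℝ) : ℂ) * I)‖ =
      2 * |Real.cos x - Real.cos y| := by
  have h1 := norm_one_sub_exp_sq (x - y)
  have h2 := norm_one_sub_exp_sq (x + y)
  have hsq : (‖1 - cexp (((x - y : ℝ) : ℂ) * I)‖ * ‖1 - cexp (((x + y : ℝ) : ℂ) * I)‖) ^ 2 =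
      (2 * |Real.cos x - Real.cos y|) ^ 2 := by
    rw [mul_pow, h1, h2, mul_pow, sq_abs, Real.cos_sub, Real.cos_add]
    nlinarith [Real.sin_sq_add_cos_sq x, Real.sin_sq_add_cos_sq y]
  exact (sq_eq_sq₀ (by positivity) (by positivity)).1 hsq

/-- **Symmetrised kernel (K1).** If `cos x ≠ cos y` then
`ℓ(x − y) + ℓ(x + y) = log (2 |cos x − cos y|)` (`= log |e^{ix} − e^{iy}| + log |e^{ix} − e^{-iy}|`).
[folklore] -/
theorem circleLogKernel_sub_add_circleLogKernel_add {x y : ℝ} (h : Real.cos x ≠ Real.cos y) :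
    circleLogKernel (x - y) + circleLogKernel (x + y) = Real.log (2 * |Real.cos x - Real.cos y|) := by
  have hprod := norm_one_sub_exp_sub_mul_norm_one_sub_exp_add x y
  have hne : 2 * |Real.cos x - Real.cos y| ≠ 0 := by
    have : Real.cos x - Real.cos y ≠ 0 := sub_ne_zero.2 h
    positivity
  have ha : ‖1 - cexp (((x - y : ℝ) : ℂ) * I)‖ ≠ 0 := fun h0 => hne (by rw [← hprod, h0, zero_mul])
  have hb : ‖1 - cexp (((x + y : ℝ) : ℂ) * I)‖ ≠ 0 := fun h0 => hne (by rw [← hprod, h0, mul_zero])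
  rw [circleLogKernel, circleLogKernel, ← Real.log_mul ha hb, hprod]

/-- **Joukowski form (K2).** For `0 < ρ < 1` and `C = (ρ + ρ⁻¹)/2 > 1`:
`log (C + cos β) = 2 ℓ_ρ(β + π) − log (2ρ)`, from `C + cos β = |1 + ρ e^{iβ}|² / (2ρ)`. [folklore] -/
theorem log_joukowski_add_cos {ρ : ℝ} (hρ0 : 0 < ρ) (hρ1 : ρ < 1) (β : ℝ) :
    Real.log ((ρ + ρ⁻¹) / 2 + Real.cos β) =
      2 * circleLogKernelR ρ (β + π) - Real.log (2 * ρ) := by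
  have hsq := norm_one_sub_mul_exp_sq ρ (β + π)
  rw [Real.cos_add_pi] at hsq
  have hpos : 0 < ‖1 - (ρ : ℂ) * cexp (((β + π : ℝ) : ℂ) * I)‖ :=
    lt_of_lt_of_le (by linarith) (one_sub_le_norm_one_sub_mul_exp hρ0.le (β + π))
  have hC : (ρ + ρ⁻¹) / 2 + Real.cos β = ‖1 - (ρ : ℂ) * cexp (((β + π : ℝ) : ℂ) * I)‖ ^ 2 / (2 * ρ) := by
    rw [hsq]; field_simp; ring
  rw [hC, Real.log_div (by positivity) (by positivity), Real.log_pow, circleLogKernelR]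
  push_cast
  ring

/-! ### Potentials of trigonometric densities -/

/-- **Convolution with `a + b cos`.** For `0 ≤ r < 1`:
`∫_{-π}^{π} ℓ_r(u − β) (a + b cos β) dβ = −π r b cos u`. [folklore] -/
theorem integral_circleLogKernelR_sub_mul {r : ℝ} (hr0 : 0 ≤ r) (hr1 : r < 1) (u a b : ℝ) :
    ∫ β in (-π)..π, circleLogKernelR r (u - β) * (a + b * Real.cos β) =
      -π * r * b * Real.cos u := by
  set H : ℝ → ℝ := fun v => circleLogKernelR r v * (a + b * Real.cos (u - v)) with hH
  have h1 : (∫ β in (-π)..π, circleLogKernelR r (u - β) * (a + b * Real.cos β)) =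
      ∫ β in (-π)..π, H (u - β) := by
    apply intervalIntegral.integral_congr; intro β _; simp [hH]
  have hp : Function.Periodic H (2 * π) := fun v => by
    simp only [hH, periodic_circleLogKernelR r v, ← sub_sub, Real.cos_sub_two_pi]
  rw [h1, intervalIntegral.integral_comp_sub_left H u, show u - -π = (u - π) + 2 * π by ring,
    hp.intervalIntegral_add_eq (u - π) (-π), show -π + 2 * π = π by ring]
  have h2 : ∀ v, H v = a * circleLogKernelR r v + b * Real.cos u * (circleLogKernelR r v * Real.cos v)
      + b * Real.sin u * (circleLogKernelR r v * Real.sin v) := fun v => by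
    simp only [hH, Real.cos_sub]; ring
  simp_rw [h2]
  have hi1 := intervalIntegrable_circleLogKernelR r (-π) π
  have hi2 : IntervalIntegrable (fun v => circleLogKernelR r v * Real.cos v) volume (-π) π :=
    hi1.mul_continuousOn Real.continuous_cos.continuousOn
  have hi3 : IntervalIntegrable (fun v => circleLogKernelR r v * Real.sin v) volume (-π) π :=
    hi1.mul_continuousOn Real.continuous_sin.continuousOn
  rw [intervalIntegral.integral_add ((hi1.const_mul a).add (hi2.const_mul _)) (hi3.const_mul _),
    intervalIntegral.integral_add (hi1.const_mul a) (hi2.const_mul _),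
    intervalIntegral.integral_const_mul, intervalIntegral.integral_const_mul,
    intervalIntegral.integral_const_mul, integral_circleLogKernelR hr0 hr1,
    integral_circleLogKernelR_mul_cos hr0 hr1, integral_circleLogKernelR_mul_sin]
  ring

/-- **Convolution with `a + b cos`, the kernel itself.**
`∫_{-π}^{π} ℓ(u − β) (a + b cos β) dβ = −π b cos u`; e.g. the logarithmic potential of the density
`(1 + γ cos)/(2π)` is `−(γ/2) cos`. [folklore] -/
theorem integral_circleLogKernel_sub_mul (u a b : ℝ) :
    ∫ β in (-π)..π, circleLogKernel (u - β) * (a + b * Real.cos β) = -π * b * Real.cos u := by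
  set H : ℝ → ℝ := fun v => circleLogKernel v * (a + b * Real.cos (u - v)) with hH
  have h1 : (∫ β in (-π)..π, circleLogKernel (u - β) * (a + b * Real.cos β)) =
      ∫ β in (-π)..π, H (u - β) := by
    apply intervalIntegral.integral_congr; intro β _; simp [hH]
  have hp : Function.Periodic H (2 * π) := fun v => by
    simp only [hH, periodic_circleLogKernel v, ← sub_sub, Real.cos_sub_two_pi]
  rw [h1, intervalIntegral.integral_comp_sub_left H u, show u - -π = (u - π) + 2 * π by ring,
    hp.intervalIntegral_add_eq (u - π) (-π), show -π + 2 * π = π by ring]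
  have h2 : ∀ v, H v = a * circleLogKernel v + b * Real.cos u * (circleLogKernel v * Real.cos v)
      + b * Real.sin u * (circleLogKernel v * Real.sin v) := fun v => by
    simp only [hH, Real.cos_sub]; ring
  simp_rw [h2]
  have hi1 := intervalIntegrable_circleLogKernel (-π) π
  have hi2 : IntervalIntegrable (fun v => circleLogKernel v * Real.cos v) volume (-π) π :=
    hi1.mul_continuousOn Real.continuous_cos.continuousOn
  have hi3 : IntervalIntegrable (fun v => circleLogKernel v * Real.sin v) volume (-π) π :=
    hi1.mul_continuousOn Real.continuous_sin.continuousOn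
  rw [intervalIntegral.integral_add ((hi1.const_mul a).add (hi2.const_mul _)) (hi3.const_mul _),
    intervalIntegral.integral_add (hi1.const_mul a) (hi2.const_mul _),
    intervalIntegral.integral_const_mul, intervalIntegral.integral_const_mul,
    intervalIntegral.integral_const_mul, integral_circleLogKernel,
    integral_circleLogKernel_mul_cos, integral_circleLogKernel_mul_sin]
  ring

end Literature.Analysis.Potential
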